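import Summits.BirchSwinnertonDyer.BirchSwinnertonDyer.Theorems.SmallImageMuTransferAnalyticMuZeroX9TeichSpanDefs
import Literature.NumberTheory.EllipticCurves.Rank1Residual.CyclotomicWindingSpan
import Literature.NumberTheory.EllipticCurves.Rank1Residual.MuLambdaCarriers
import Literature.NumberTheory.EllipticCurves.PAdicLFunctionMultiplicativeInterpolation
import Summits.BirchSwinnertonDyer.BirchSwinnertonDyer.Theorems.PrintX11aNonSurjMuAnHardDefs
import HarnessLib

/-!
# Crux U5 `PrintX11a.UpperNonSurjFive` (item stmt-BirchSwinnertonDyer-20614) — the «multteich5» vocabulary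
# (MULT Teichmüller packets of `Γ₀(pM)` read at the cusp `1/p`, `MultTeichSpanGen M p`, the two carriers)

Seat `bsd-line-x11a-p3` g2 (LEAD of crux 20614, route `route-BirchSwinnertonDyer-PrintX11a`).  DEFINITIONS ONLY (plus
proved bookkeeping lemmas; nothing is asserted about any level or curve; no named fact; no `sorry`).  The eight
definitions are VERBATIM §«The transferred objects» of the ideator's published line `Cruxes/UpperNonSurjFive/Lines/multteich5.lean`
(seat bsd-idea-17, lens «transfer», 2026-08-28, commit 012ad827e89e / v2), in the line's own namespace
`Summit.BirchSwinnertonDyer.BirchSwinnertonDyer.Cruxes.UpperNonSurjFive.MultTeich`, filed as a tree module so that (i) the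
lead's reshaped skeleton of record (finemu5 r2 = finemu5 ⊕ multteich5: the μ-road's raw input `stub_muAnHardFive` is
decomposed into S1 `stub_multTeichSpan` | S2 `stub_orbitUnit_of_multTeichSpan` | S3 `stub_multMuAn_of_orbitUnit`) and the
stub files can `import` it and state the registered signatures with IDENTICAL fully-qualified names, and (ii) the closer
composes BY NAME — exactly the precedent of `Theorems/SmallImageMuTransferAnalyticMuZeroX9TeichSpanDefs.lean` (the
good-level sibling B⁰ vocabulary `TeichSpan.*` of cell `bsd-f3-mu`, which this file imports for `TeichSpan.iotaGamma0`).

The objects (Manin 1972 Prop. 1.4: `γ ↦ {r → γ·r}` is a homomorphism `Γ₀(N) → H₁(X₀(N), cusps; ℤ)` for every cusp `r`,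
killing elliptic and parabolic elements; Mazur–Tate–Teitelbaum 1986 §I.10: at `p ∥ N` the one-root measure is
`μ(a + pⁿℤ_p) = a_p^{-n}[a/pⁿ]⁺`, whose `ω⁰`-branch Riemann sums are the Teichmüller-orbit sums
`A_n(u) = Σ_{η ∈ μ_{p−1}} [ηu/pⁿ]⁺ = Rank1Residual.teichOrbitSum`):
* `numEntry p γ = a + p·b`, `denEntry p γ = c + p·d` — numerator and denominator of `γ·(1/p)`, `γ = (a b; c d)`
  (`ν·d − b·δ = ad − bc = 1`, so `ν` is a unit modulo `δ`);
* `IsMultTeichPacket N p n l` — `p − 1` elements of `Γ₀(N)` with `δ = pⁿ` whose numerators are pairwise distinct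
  mod `pⁿ` with a common `(p−1)`-th power (so the cusps `γ·(1/p) = ν/pⁿ` run once through a Teichmüller coset
  `u·μ_{p−1} ⊂ (ℤ/pⁿ)ˣ`; under `γ ↦ [γ(1/p)]⁺ − [1/p]⁺` the product goes to `A_n(u) − (p−1)[1/p]⁺`);
* `multTeichPacketProducts`, `multTeichPacketQuotients` (a quotient `π·π'⁻¹` goes to `A_n(u) − A_{n'}(u')`);
* `MultTeichSpanGen M p` — B⁰ at multiplicative level `pM`, PLUS SIDE: for every `γ ∈ Γ₁(pM)` the `ι`-norm `γ·γ^ι`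
  lies in `⟨packet quotients ∪ finite-order ∪ trace ±2 ∪ p-th powers⟩ · [Γ₀(pM), Γ₀(pM)]`; an OPEN statement of
  elementary group theory (the ideator's census: 23/23 levels `pM ≤ 301`, `p ∈ {5,7}`, exact Manin symbols mod `p`);
* `MultTeichOrbitUnitAt W p` — some orbit sum `A_n(a)`, `n ≥ 1`, `a` a unit, of the newform of `W` has norm `≥ 1`;
* `MultMuAnAt W p` — the per-pair tail of `Theorems.X11aNonSurjMuAnHardFive`: some coefficient of `ϖ·L` is a unit for
  every Mazur–Tate–Teitelbaum function `L` of the newform at `p` with the allowable root `a = ±1`.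
Appended (§1, all proved): entry identities (`numEntry_mul_dEntry_sub`), unit-ness of `ν` mod `pⁿ`, membership and
unfolding lemmas.

HONEST FRAMING: predicates only; `MultTeichSpanGen` is OPEN (for `p`-new irreducible eigenclasses it is Greenberg's
analytic `ω⁰`-conjecture; it also binds `p`-old and mixed classes); nothing here claims it; beyond-print theorem: no.
BSD is not proved by any of this.  The `ℕ`-subtraction `p - 1` in `IsMultTeichPacket` is harmless (used at `p ≥ 5`) and is
the sibling's convention (`TeichSpan.IsTeichPacket`).

References: [Manin1972] Prop. 1.4, Thm. 1.9; [MazurTateTeitelbaum1986Invent] §I.10 (10.1); [GreenbergLNM1716] Conj. 1.11;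
[Sun2007] §4 (un-averaged span; the averaged/packet version is not in print).
-/

noncomputable section

open scoped Classical MatrixGroups ModularForm
open CongruenceSubgroup
open Literature.NumberTheory.EllipticCurves Literature.NumberTheory.EllipticCurves.ModularForms
  Literature.NumberTheory.EllipticCurves.Rank1Residual

-- the summit and its single problem are both named `BirchSwinnertonDyer` (registry layout D-0017)
set_option linter.dupNamespace false

namespace Summit.BirchSwinnertonDyer.BirchSwinnertonDyer.Cruxes.UpperNonSurjFive.MultTeich

open Summit.BirchSwinnertonDyer.BirchSwinnertonDyer.Cruxes.AnalyticMuZeroX9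

/-! ### §0 The transferred objects (VERBATIM `Lines/multteich5.lean`, ideator bsd-idea-17) -/

/-- Numerator `ν(γ) = a + p·b` of `γ(1/p) = (a + p b)/(c + p d)`, `γ = (a b; c d) ∈ Γ₀(N)`.
[cite: Manin1972, Prop. 1.4] -/
def numEntry {N : ℕ} (p : ℕ) (γ : Gamma0 N) : ℤ :=
  ((γ : SL(2, ℤ)) 0 0 : ℤ) + (p : ℤ) * ((γ : SL(2, ℤ)) 0 1 : ℤ)

/-- Denominator `δ(γ) = c + p·d` of `γ(1/p)`, `γ = (a b; c d) ∈ Γ₀(N)`. [cite: Manin1972, Prop. 1.4] -/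
def denEntry {N : ℕ} (p : ℕ) (γ : Gamma0 N) : ℤ :=
  ((γ : SL(2, ℤ)) 1 0 : ℤ) + (p : ℤ) * ((γ : SL(2, ℤ)) 1 1 : ℤ)

/-- **MULT Teichmüller packet of level `n`**: `p − 1` elements of `Γ₀(N)` carrying the cusp `1/p` to cusps `ν/pⁿ`
(denominator `δ = pⁿ` on the nose) whose numerators are pairwise distinct mod `pⁿ` with a common `(p−1)`-th power —
i.e. run once through a Teichmüller coset `u·μ_{p−1} ⊂ (ℤ/pⁿ)ˣ`.  The transfer of `TeichSpan.IsTeichPacket`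
(`d = pⁿ`, `b`-entries a coset) from the cusp `0` to the cusp `1/p`. [cite: MazurTateTeitelbaum1986Invent, §I.10 (10.1)] -/
def IsMultTeichPacket (N p n : ℕ) (l : List (Gamma0 N)) : Prop :=
  l.length = p - 1 ∧ (∀ g ∈ l, denEntry p g = (p : ℤ) ^ n) ∧
    (l.map fun g => ((numEntry p g : ℤ) : ZMod (p ^ n))).Nodup ∧
    ∃ c : ZMod (p ^ n), ∀ g ∈ l, ((numEntry p g : ℤ) : ZMod (p ^ n)) ^ (p - 1) = c

/-- Products of mult packets of all levels `n ≥ 1` (under `γ ↦ [γ(1/p)]⁺ − [1/p]⁺`: `A_n(u) − (p−1)[1/p]⁺`).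
[cite: Manin1972, Prop. 1.4] -/
def multTeichPacketProducts (N p : ℕ) : Set (Gamma0 N) :=
  {γ | ∃ (n : ℕ) (l : List (Gamma0 N)), 1 ≤ n ∧ IsMultTeichPacket N p n l ∧ γ = l.prod}

/-- Quotients of two packet products (under the same map: `A_n(u) − A_{n'}(u')`, the base-cusp term cancels).
[cite: Manin1972, Prop. 1.4] -/
def multTeichPacketQuotients (N p : ℕ) : Set (Gamma0 N) :=
  {γ | ∃ π ∈ multTeichPacketProducts N p, ∃ π' ∈ multTeichPacketProducts N p, γ = π * π'⁻¹}

/-- **B⁰ at multiplicative level `p·M` — `MultTeichSpanGen M p`** (PLUS SIDE, the shape of `TeichSpan.TeichSpanGen` with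
`Γ₁(pM)` in place of the good elements and packet QUOTIENTS in place of packet products): for every `γ ∈ Γ₁(pM)` the
`ι`-norm `γ·γ^ι` lies in `⟨packet quotients ∪ finite-order ∪ trace ±2 ∪ p-th powers⟩ · [Γ₀(pM), Γ₀(pM)]`.  Dually: every
additive character `H₁(X₀(pM);ℤ) → 𝔽_p` killing the packet-quotient classes has EISENSTEIN even part.  A PREDICATE on
`(M, p)`; OPEN; nothing asserted (census of the ideator seat bsd-idea-17: 23/23 levels). [cite: Manin1972, Prop. 1.4]
[cite: Sun2007, §4 — the un-averaged span; the packet version is not in print] -/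
def MultTeichSpanGen (M p : ℕ) : Prop :=
  ∀ γ : Gamma0 (p * M), γ ∈ Gamma1' (p * M) →
    γ * TeichSpan.iotaGamma0 γ ∈
      Subgroup.closure (multTeichPacketQuotients (p * M) p ∪ trivialGens (p * M) ∪ pthPowers (p * M) p) ⊔
        commutator (Gamma0 (p * M))

/-- **Transferred carrier**: for every newform `f` of `E = W`, some Teichmüller orbit sum `A_n(a)` of level `n ≥ 1`
over a unit `a` (`Rank1Residual.teichOrbitSum`) has `p`-adic norm `≥ 1`. A predicate; nothing asserted.
[cite: MazurTateTeitelbaum1986Invent, §I.10 (10.1)] -/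
def MultTeichOrbitUnitAt (W : WeierstrassCurve ℚ) (p : ℕ) [Fact p.Prime] : Prop :=
  ∀ {N : ℕ} [NeZero N] (f : CuspForm (Gamma0 N) 2), IsNewformOf W f →
    ∃ n : ℕ, 1 ≤ n ∧ ∃ a : (ZMod (p ^ n))ˣ, 1 ≤ ‖((teichOrbitSum f p n (a : ZMod (p ^ n)) : ℚ) : ℚ_[p])‖

/-- **The μ-claim of the crux in its native per-pair shape** (verbatim tail of `Theorems.X11aNonSurjMuAnHardFive`): for
every newform `f` of `W`, period ratio `ϖ` (`ϖ·Ω_W = Ω⁺_f`) and Mazur–Tate–Teitelbaum function `L` at `p` with the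
allowable root `a` (`a = 1` split, `a = −1` non-split), SOME coefficient of `ϖ·L` is a `p`-adic unit. A predicate;
nothing asserted. [cite: MazurTateTeitelbaum1986Invent, §I.10–I.13] [cite: GreenbergLNM1716, Conj. 1.11 (shape only)] -/
def MultMuAnAt (W : WeierstrassCurve ℚ) [W.IsElliptic] (p : ℕ) [Fact p.Prime] : Prop :=
  ∀ {N : ℕ} [NeZero N] (f : CuspForm (Gamma0 N) 2), IsNewformOf W f →
    ∀ (ϖ : ℚ), (ϖ : ℝ) * W.realPeriodRat = plusPeriod f →
    ∀ (a : ℚ_[p]) (L : PowerSeries ℚ_[p]),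
      (W.HasSplitMultiplicativeReductionAtPrime p → a = 1) →
      (¬ W.HasSplitMultiplicativeReductionAtPrime p → a = -1) →
      IsMultPAdicLFunctionOf f p a L →
      ∃ n : ℕ, ‖PowerSeries.coeff n (PowerSeries.C ((ϖ : ℚ) : ℚ_[p]) * L)‖ = 1

/-! ### §1 Bookkeeping lemmas (all proved) -/

variable {N : ℕ}

/-- Unfolding `numEntry`. [cite: Manin1972, Prop. 1.4] -/
theorem numEntry_def (p : ℕ) (γ : Gamma0 N) :
    numEntry p γ = ((γ : SL(2, ℤ)) 0 0 : ℤ) + (p : ℤ) * ((γ : SL(2, ℤ)) 0 1 : ℤ) := rfl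

/-- Unfolding `denEntry`. [cite: Manin1972, Prop. 1.4] -/
theorem denEntry_def (p : ℕ) (γ : Gamma0 N) :
    denEntry p γ = ((γ : SL(2, ℤ)) 1 0 : ℤ) + (p : ℤ) * ((γ : SL(2, ℤ)) 1 1 : ℤ) := rfl

/-- **`ν·d − b·δ = 1`**: the vector `(ν, δ) = γ·(1, p)ᵀ` is unimodular with the second column of `γ` as witness
(`ad − bc = 1`). [cite: Manin1972, Prop. 1.4] -/
theorem numEntry_mul_sub_mul_denEntry (p : ℕ) (γ : Gamma0 N) :
    numEntry p γ * ((γ : SL(2, ℤ)) 1 1 : ℤ) - ((γ : SL(2, ℤ)) 0 1 : ℤ) * denEntry p γ = 1 := by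
  have h := Matrix.SpecialLinearGroup.det_coe (γ : SL(2, ℤ))
  rw [Matrix.det_fin_two] at h
  rw [numEntry, denEntry]
  linear_combination h

/-- The numerator of a packet element is a unit mod `pⁿ` (`ν·d ≡ 1 (mod δ)`, `δ = pⁿ`). [cite: Manin1972, Prop. 1.4] -/
theorem isUnit_numEntry_of_denEntry_eq {p n : ℕ} {g : Gamma0 N} (hd : denEntry p g = (p : ℤ) ^ n) :
    IsUnit (((numEntry p g : ℤ)) : ZMod (p ^ n)) := by
  have h := numEntry_mul_sub_mul_denEntry p g
  rw [hd] at h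
  have hpn : (((p : ℤ) ^ n : ℤ) : ZMod (p ^ n)) = 0 := by
    rw [Int.cast_pow, Int.cast_natCast, ← Nat.cast_pow, ZMod.natCast_self]
  have h' : (((numEntry p g : ℤ)) : ZMod (p ^ n)) * ((((g : SL(2, ℤ)) 1 1 : ℤ)) : ZMod (p ^ n)) = 1 := by
    have := congr_arg (Int.cast : ℤ → ZMod (p ^ n)) h
    push_cast at this hpn ⊢
    rw [hpn] at this
    linear_combination this
  exact IsUnit.of_mul_eq_one _ h'

/-- The denominator of an element of a mult packet is `pⁿ`. [cite: MazurTateTeitelbaum1986Invent, §I.10 (10.1)] -/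
theorem denEntry_eq_of_isMultTeichPacket {p n : ℕ} {l : List (Gamma0 N)} (h : IsMultTeichPacket N p n l)
    {g : Gamma0 N} (hg : g ∈ l) : denEntry p g = (p : ℤ) ^ n :=
  h.2.1 g hg

/-- Packet products are packet products. [cite: Manin1972, Prop. 1.4] -/
theorem prod_mem_multTeichPacketProducts {p n : ℕ} {l : List (Gamma0 N)} (hn : 1 ≤ n)
    (h : IsMultTeichPacket N p n l) : l.prod ∈ multTeichPacketProducts N p :=
  ⟨n, l, hn, h, rfl⟩

/-- Quotients of packet products are packet quotients. [cite: Manin1972, Prop. 1.4] -/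
theorem mul_inv_mem_multTeichPacketQuotients {p : ℕ} {π π' : Gamma0 N}
    (hπ : π ∈ multTeichPacketProducts N p) (hπ' : π' ∈ multTeichPacketProducts N p) :
    π * π'⁻¹ ∈ multTeichPacketQuotients N p :=
  ⟨π, hπ, π', hπ', rfl⟩

/-- Unfolding `MultTeichSpanGen`. [cite: Manin1972, Prop. 1.4] -/
theorem multTeichSpanGen_iff (M p : ℕ) :
    MultTeichSpanGen M p ↔ ∀ γ : Gamma0 (p * M), γ ∈ Gamma1' (p * M) →
      γ * TeichSpan.iotaGamma0 γ ∈
        Subgroup.closure (multTeichPacketQuotients (p * M) p ∪ trivialGens (p * M) ∪ pthPowers (p * M) p) ⊔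
          commutator (Gamma0 (p * M)) := Iff.rfl

/-- Unfolding `MultTeichOrbitUnitAt`. [cite: MazurTateTeitelbaum1986Invent, §I.10 (10.1)] -/
theorem multTeichOrbitUnitAt_iff (W : WeierstrassCurve ℚ) (p : ℕ) [Fact p.Prime] :
    MultTeichOrbitUnitAt W p ↔ ∀ {N : ℕ} [NeZero N] (f : CuspForm (Gamma0 N) 2), IsNewformOf W f →
      ∃ n : ℕ, 1 ≤ n ∧ ∃ a : (ZMod (p ^ n))ˣ, 1 ≤ ‖((teichOrbitSum f p n (a : ZMod (p ^ n)) : ℚ) : ℚ_[p])‖ :=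
  Iff.rfl

end Summit.BirchSwinnertonDyer.BirchSwinnertonDyer.Cruxes.UpperNonSurjFive.MultTeich

end
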